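import Literature.NumberTheory.Automorphic.UnitaryGroupKernelBorelClassUnipotentTwo
import Literature.NumberTheory.Automorphic.UnitaryGroupHeisenbergLatticeCollapse
import Literature.NumberTheory.Automorphic.UnitaryGroupLineUnipotentTwo
import HarnessLib

/-!
# The unfolded bracket of the unipotent term of `U(J₂)` is left `N(𝔸_F)`-invariant:
# `ψ_T(n y) = ψ_T(y)`, `ψ_T(y) = Σ'_{u ∈ N(F), u ≠ 1} f(y⁻¹ z₁ u y) − 1_{T < H(y)} K_{B,𝔬}(y, y)`
(Rogawski, *Automorphic Representations of Unitary Groups in Three Variables* (1990), §7.3 pp. 96–98: «Using the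
decomposition `G = NMK` and `dg = |δ_B(m)|⁻¹ dn dm dk` … we write this as the integral over `ZM∖M` and `N∖N` … since
`m(N∖N) = 1`», and Prop. 7.3.1 (p. 98) — the term of a central `γ` for `G = U(2)`, `U(2) × U(1)`: there `N` is the
one-parameter group `n(b)`, `b + b̄ = 0`, which is ABELIAN; Arthur, *The trace formula in invariant form* (1981), §2.)

Topic `NumberTheory/Automorphic`; namespace `Literature.NumberTheory.Automorphic.UnitaryGroup`. THEOREMS ONLY over
accepted tree modules (no definition, no named fact, no instance, no notation, no `sorry`). H-side (σ-u) row at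
`N = 2` (cell `pub/hodgecm-mathlib`, crux H413, census `CENSUS-LAWS-Hside` §3 (σ-u)): the hypothesis `hN` —
LEFT-`N(𝔸_F)`-INVARIANCE of the integrand — of ★ (C-G)_two `exists_weight_torus_kAverage_of_unipotent_invariant_two`
(`UnitaryGroupUnipotentInvariantUnfoldingTwo`), AT THE BRACKET `ψ_T` of ★ B1_two
`truncatedTraceClass_central_eq_add_mul_integral_two` (spelled INLINE, token for token). At `N = 3` the bracket splits
into a centre-lattice part (left-`N(𝔸)`-invariant, ★ `tsum_centre_conj_unipotent_mul`) and a Heisenberg part (NOT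
invariant, integrated over `n ∈ Ω_N` by the (E-GN) Fubini stage); at `N = 2` the unipotent radical `N(𝔸_F) ≅ 𝔸_E⁻` is a
LINE — abelian (★ H-B1 `mul_comm_adelicUnipotent_two`) — and `z₁` is central (★ `toAdelic_ratCenter_mul_comm_fin`), so the
WHOLE bracket is left-`N(𝔸_F)`-invariant and the group → torus unfolding of the (σ-u) head is ONE call of ★ (C-G)_two (B)
with `hN` = this file, `hBF`∕measurability = ★ B1_two §2 (`bracket_rational_borel_mul_two`, `measurable_bracket_two`),
`hfin` = ★ (HINT)_two `lintegral_weight_mul_enorm_bracket_lt_top_two`.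

* §1 `kernelBorelClass_diag_unipotent_mul_central_two` — `K_{B,𝔬}(n y, n y) = K_{B,𝔬}(y, y)` at the central class
  (★ brick (4) `kernelBorelClass_eq_smul_integral_central_two`: `K_{B,𝔬}(x, y) = ν(𝓕)⁻¹ ∫_N f(x⁻¹ z₁ m y) dν`, `z₁` central,
  `m ↦ n⁻¹ m n` preserves the Haar measure of the abelian `N(𝔸_F)` ★ `isMulRightInvariant_of_isMulLeftInvariant_two`);
  `kernelBorelTailClass_unipotent_mul_central_two` — the cut-off tail `1_{T<H} K_{B,𝔬}` likewise (★ generic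
  `kernelBorelTailClass_unipotent_mul_of_diag`, `H(n y) = H(y)` ★ `borelHeight_unipotent_mul`).
* §2 `apply_conj_central_unipotent_mul_two` — TERMWISE: `f((n y)⁻¹ (z₁ u) (n y)) = f(y⁻¹ (z₁ u) y)` for `u ∈ N(F)`,
  `n ∈ N(𝔸_F)` (`n⁻¹ (z₁ u) n = z₁ u`); `tsum_rationalUnipotent_ne_one_unipotent_mul_two` — the `u`-sum is invariant.
* §3 **`bracket_unipotent_mul_two`** — `ψ_T(↑n * y) = ψ_T(y)` for `n : unipotentInBorel F E c 2` (coerced through `B(𝔸_F)`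
  into `G(𝔸_F)`, EXACTLY the binder shape `hN` of ★ (C-G)_two); `bracket_adelicUnipotent_mul_two` — the same for
  `n ∈ adelicUnipotent F E c 2`.

HC_CM is proved only modulo the 7 printed citations until rung 0 closes — nothing here bears on a summit statement.

## References
* J. D. Rogawski, *Automorphic Representations of Unitary Groups in Three Variables*, Ann. of Math. Stud. 123 (1990),
  §7.3 (pp. 96–98), Prop. 7.3.1 (p. 98); §2.2 (p. 13); §1.10 [Rogawski1990].
* J. Arthur, *The trace formula in invariant form*, Ann. of Math. 114 (1981), §2 [Arthur1981TraceFormulaInvariantForm].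
-/

set_option autoImplicit false

noncomputable section

open MeasureTheory MeasureTheory.Measure Set NumberField IsDedekindDomain Polynomial
open scoped ENNReal NNReal

namespace Literature.NumberTheory.Automorphic

namespace UnitaryGroup

variable {F E : Type} [Field F] [NumberField F] [Field E] [NumberField E] [Algebra F E]
  {c : E ≃ₐ[F] E} {ι : Type*}

variable (ζ : ratOne F E c) {z₁ : (quasiSplit F E c 2).arithmeticSubgroup}

/-! ## §1 The class Borel kernel and its cut-off tail are left `N(𝔸_F)`-invariant at the central class of `U(J₂)` -/

section Tail

variable [MeasurableSpace (adelicUnipotent F E c 2)] [BorelSpace (adelicUnipotent F E c 2)]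

/-- **At the central class of `U(J₂)`, `K_{B,𝔬}(n y, n y) = K_{B,𝔬}(y, y)` for `n ∈ N(𝔸_F)`**: by ★ brick (4)
`kernelBorelClass_eq_smul_integral_central_two` `K_{B,𝔬}(y, y) = ν(𝓕)⁻¹ ∫_N f(y⁻¹ z₁ m y) dν(m)`, `z₁` is central (★
`toAdelic_ratCenter_mul_comm_fin`) and `m ↦ n⁻¹ m n` preserves the Haar measure of the ABELIAN `N(𝔸_F) ≅ 𝔸_E⁻` (★
`isMulRightInvariant_of_isMulLeftInvariant_two`) — the `N = 2` twin of ★ `kernelBorelClass_diag_unipotent_mul_central`.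
[cite: Rogawski1990, §2.2 (p. 13)] [cite: Rogawski1990, Prop. 7.3.1 (p. 98)] -/
theorem kernelBorelClass_diag_unipotent_mul_central_two {cl : (quasiSplit F E c 2).arithmeticSubgroup → ι}
    (ν : Measure (adelicUnipotent F E c 2)) [ν.IsHaarMeasure]
    {𝓕 : Set (adelicUnipotent F E c 2)} (h𝓕 : IsFundamentalDomain (rationalUnipotent F E c 2) 𝓕 ν)
    (hclN : IsUnipotentInvariantOnBorel F E c 2 cl) {i : ι}
    (hcl : ∀ γ : (quasiSplit F E c 2).arithmeticSubgroup, cl γ = i ↔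
      ((adelicVal F E c 2 _ (γ : (quasiSplit F E c 2).Adelic) : GL (Fin 2) (AdeleRing (𝓞 E) E)) :
          Matrix (Fin 2) (Fin 2) (AdeleRing (𝓞 E) E)).charpoly =
        ((X - C ((ζ : Eˣ) : E)) ^ 2).map (algebraMap E (AdeleRing (𝓞 E) E)))
    {f : (quasiSplit F E c 2).Adelic → ℂ} (hfc : Continuous f) (hf : HasCompactSupport f)
    {n : (quasiSplit F E c 2).Adelic} (hn : n ∈ adelicUnipotent F E c 2) (y : (quasiSplit F E c 2).Adelic) :
    kernelBorelClass ν 𝓕 cl i f (n * y) (n * y) = kernelBorelClass ν 𝓕 cl i f y y := by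
  haveI := isMulRightInvariant_of_isMulLeftInvariant_two (F := F) (E := E) (c := c) ν
  rw [kernelBorelClass_eq_smul_integral_central_two ν h𝓕 hclN ζ hcl hfc hf (n * y) (n * y),
    kernelBorelClass_eq_smul_integral_central_two ν h𝓕 hclN ζ hcl hfc hf y y]
  refine congrArg (fun I : ℂ => ((ν 𝓕).toReal⁻¹ : ℝ) • I) ?_
  set zA := (quasiSplit F E c 2).toAdelic (ratCenter F E c 2 ((StdForm.antidiagonal 2).over E) ζ) with hzA
  let n' : adelicUnipotent F E c 2 := ⟨n, hn⟩
  have hn' : ((n' : adelicUnipotent F E c 2) : (quasiSplit F E c 2).Adelic) = n := rfl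
  -- `(n y)⁻¹ z₁ m (n y) = y⁻¹ z₁ (n⁻¹ m n) y`
  have hpt : ∀ m : adelicUnipotent F E c 2,
      f ((n * y)⁻¹ * zA * ((m : adelicUnipotent F E c 2) : (quasiSplit F E c 2).Adelic) * (n * y)) =
        f (y⁻¹ * zA * (((n'⁻¹ * m * n' : adelicUnipotent F E c 2)) : (quasiSplit F E c 2).Adelic) * y) := by
    intro m
    refine congrArg f ?_
    have hz : zA * n⁻¹ = n⁻¹ * zA := toAdelic_ratCenter_mul_comm_fin ζ n⁻¹
    rw [Subgroup.coe_mul, Subgroup.coe_mul, Subgroup.coe_inv, hn', _root_.mul_inv_rev]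
    simp only [mul_assoc]
    rw [← mul_assoc n⁻¹ zA, ← hz, mul_assoc]
  simp_rw [hpt]
  -- `m ↦ n⁻¹ m n` preserves `ν`
  have h1 : ∫ m : adelicUnipotent F E c 2, f (y⁻¹ * zA * (((n'⁻¹ * m * n' : adelicUnipotent F E c 2)) :
      (quasiSplit F E c 2).Adelic) * y) ∂ν =
      ∫ m : adelicUnipotent F E c 2, f (y⁻¹ * zA * (((n'⁻¹ * (m * n') : adelicUnipotent F E c 2)) :
        (quasiSplit F E c 2).Adelic) * y) ∂ν := by
    simp_rw [mul_assoc]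
  rw [h1, integral_mul_right_eq_self (fun m : adelicUnipotent F E c 2 =>
    f (y⁻¹ * zA * (((n'⁻¹ * m : adelicUnipotent F E c 2)) : (quasiSplit F E c 2).Adelic) * y)) n',
    integral_mul_left_eq_self (fun m : adelicUnipotent F E c 2 =>
    f (y⁻¹ * zA * ((m : adelicUnipotent F E c 2) : (quasiSplit F E c 2).Adelic) * y)) n'⁻¹]

/-- **The class tail is `N(𝔸_F)`-invariant at the central class of `U(J₂)`**: `tail_T(n y) = tail_T(y)` for
`n ∈ N(𝔸_F)` (§1 + `H(n y) = H(y)`, ★ `kernelBorelTailClass_unipotent_mul_of_diag`) — the `N = 2` twin of ★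
`kernelBorelTailClass_unipotent_mul_central`. [cite: Rogawski1990, §2.2 (p. 13)] [cite: Rogawski1990, §7.3 (p. 97)] -/
theorem kernelBorelTailClass_unipotent_mul_central_two {cl : (quasiSplit F E c 2).arithmeticSubgroup → ι}
    (ν : Measure (adelicUnipotent F E c 2)) [ν.IsHaarMeasure]
    {𝓕 : Set (adelicUnipotent F E c 2)} (h𝓕 : IsFundamentalDomain (rationalUnipotent F E c 2) 𝓕 ν)
    (hclN : IsUnipotentInvariantOnBorel F E c 2 cl) {i : ι}
    (hcl : ∀ γ : (quasiSplit F E c 2).arithmeticSubgroup, cl γ = i ↔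
      ((adelicVal F E c 2 _ (γ : (quasiSplit F E c 2).Adelic) : GL (Fin 2) (AdeleRing (𝓞 E) E)) :
          Matrix (Fin 2) (Fin 2) (AdeleRing (𝓞 E) E)).charpoly =
        ((X - C ((ζ : Eˣ) : E)) ^ 2).map (algebraMap E (AdeleRing (𝓞 E) E)))
    {f : (quasiSplit F E c 2).Adelic → ℂ} (hfc : Continuous f) (hf : HasCompactSupport f) (T : ℝ≥0)
    {n : (quasiSplit F E c 2).Adelic} (hn : n ∈ adelicUnipotent F E c 2) (y : (quasiSplit F E c 2).Adelic) :
    kernelBorelTailClass ν 𝓕 T cl i f (n * y) = kernelBorelTailClass ν 𝓕 T cl i f y :=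
  kernelBorelTailClass_unipotent_mul_of_diag
    (fun _ hn' y' => kernelBorelClass_diag_unipotent_mul_central_two ζ ν h𝓕 hclN hcl hfc hf hn' y') T hn y

end Tail

/-! ## §2 The `u`-sum is left `N(𝔸_F)`-invariant: `N(𝔸_F)` is abelian and `z₁` is central -/

section Sum

/-- **Termwise: `(n y)⁻¹ (z₁ u) (n y) = y⁻¹ (z₁ u) y`** for `n ∈ N(𝔸_F)` of `U(J₂)` and `u ∈ N(F)` — `z₁` commutes
with everything (★ `toAdelic_ratCenter_mul_comm_fin`) and `n⁻¹ u n = u` in the ABELIAN `N(𝔸_F) ≅ 𝔸_E⁻` (★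
`mul_comm_adelicUnipotent_two`). [cite: Rogawski1990, §1.10] [cite: Rogawski1990, Prop. 7.3.1 (p. 98)] -/
theorem conj_central_unipotent_eq_of_mem_adelicUnipotent_two
    (hz₁ : (z₁ : (quasiSplit F E c 2).Adelic) =
      (quasiSplit F E c 2).toAdelic (ratCenter F E c 2 ((StdForm.antidiagonal 2).over E) ζ))
    {n : (quasiSplit F E c 2).Adelic} (hn : n ∈ adelicUnipotent F E c 2) (u : rationalUnipotent F E c 2)
    (y : (quasiSplit F E c 2).Adelic) :
    (n * y)⁻¹ * ((z₁ * ⟨(((u : rationalUnipotent F E c 2) : adelicUnipotent F E c 2) : (quasiSplit F E c 2).Adelic),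
        (u : rationalUnipotent F E c 2).2⟩ : (quasiSplit F E c 2).arithmeticSubgroup) : (quasiSplit F E c 2).Adelic) *
      (n * y) =
    y⁻¹ * ((z₁ * ⟨(((u : rationalUnipotent F E c 2) : adelicUnipotent F E c 2) : (quasiSplit F E c 2).Adelic),
        (u : rationalUnipotent F E c 2).2⟩ : (quasiSplit F E c 2).arithmeticSubgroup) : (quasiSplit F E c 2).Adelic) * y := by
  -- the two commutations, on `G(𝔸_F)`
  have hz : (z₁ : (quasiSplit F E c 2).Adelic) * n⁻¹ = n⁻¹ * (z₁ : (quasiSplit F E c 2).Adelic) := by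
    rw [hz₁]; exact toAdelic_ratCenter_mul_comm_fin ζ n⁻¹
  have hu : (((u : rationalUnipotent F E c 2) : adelicUnipotent F E c 2) : (quasiSplit F E c 2).Adelic) * n =
      n * (((u : rationalUnipotent F E c 2) : adelicUnipotent F E c 2) : (quasiSplit F E c 2).Adelic) := by
    have h := mul_comm_adelicUnipotent_two ((u : rationalUnipotent F E c 2) : adelicUnipotent F E c 2) ⟨n, hn⟩
    exact congrArg (fun w : adelicUnipotent F E c 2 => (w : (quasiSplit F E c 2).Adelic)) h
  rw [Subgroup.coe_mul, _root_.mul_inv_rev]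
  change y⁻¹ * n⁻¹ * ((z₁ : (quasiSplit F E c 2).Adelic) *
      (((u : rationalUnipotent F E c 2) : adelicUnipotent F E c 2) : (quasiSplit F E c 2).Adelic)) * (n * y) =
    y⁻¹ * ((z₁ : (quasiSplit F E c 2).Adelic) *
      (((u : rationalUnipotent F E c 2) : adelicUnipotent F E c 2) : (quasiSplit F E c 2).Adelic)) * y
  calc y⁻¹ * n⁻¹ * ((z₁ : (quasiSplit F E c 2).Adelic) *
          (((u : rationalUnipotent F E c 2) : adelicUnipotent F E c 2) : (quasiSplit F E c 2).Adelic)) * (n * y)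
      = y⁻¹ * (n⁻¹ * (z₁ : (quasiSplit F E c 2).Adelic)) *
          ((((u : rationalUnipotent F E c 2) : adelicUnipotent F E c 2) : (quasiSplit F E c 2).Adelic) * n) * y := by
        simp only [mul_assoc]
    _ = y⁻¹ * ((z₁ : (quasiSplit F E c 2).Adelic) * n⁻¹) *
          (n * (((u : rationalUnipotent F E c 2) : adelicUnipotent F E c 2) : (quasiSplit F E c 2).Adelic)) * y := by
        rw [hz, hu]
    _ = y⁻¹ * ((z₁ : (quasiSplit F E c 2).Adelic) *
          (((u : rationalUnipotent F E c 2) : adelicUnipotent F E c 2) : (quasiSplit F E c 2).Adelic)) * y := by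
        simp only [mul_assoc, inv_mul_cancel_left]

/-- **Termwise invariance of the integrand**: `f((n y)⁻¹ (z₁ u) (n y)) = f(y⁻¹ (z₁ u) y)` for `n ∈ N(𝔸_F)`, `u ∈ N(F)`.
[cite: Rogawski1990, Prop. 7.3.1 (p. 98)] -/
theorem apply_conj_central_unipotent_mul_two {M : Type*} (f : (quasiSplit F E c 2).Adelic → M)
    (hz₁ : (z₁ : (quasiSplit F E c 2).Adelic) =
      (quasiSplit F E c 2).toAdelic (ratCenter F E c 2 ((StdForm.antidiagonal 2).over E) ζ))
    {n : (quasiSplit F E c 2).Adelic} (hn : n ∈ adelicUnipotent F E c 2) (u : rationalUnipotent F E c 2)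
    (y : (quasiSplit F E c 2).Adelic) :
    f ((n * y)⁻¹ * ((z₁ * ⟨(((u : rationalUnipotent F E c 2) : adelicUnipotent F E c 2) : (quasiSplit F E c 2).Adelic),
        (u : rationalUnipotent F E c 2).2⟩ : (quasiSplit F E c 2).arithmeticSubgroup) : (quasiSplit F E c 2).Adelic) *
      (n * y)) =
    f (y⁻¹ * ((z₁ * ⟨(((u : rationalUnipotent F E c 2) : adelicUnipotent F E c 2) : (quasiSplit F E c 2).Adelic),
        (u : rationalUnipotent F E c 2).2⟩ : (quasiSplit F E c 2).arithmeticSubgroup) : (quasiSplit F E c 2).Adelic) * y) :=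
  congrArg f (conj_central_unipotent_eq_of_mem_adelicUnipotent_two ζ hz₁ hn u y)

/-- **The `u`-sum of the bracket is left `N(𝔸_F)`-invariant**:
`Σ'_{u ≠ 1} f((n y)⁻¹ z₁ u (n y)) = Σ'_{u ≠ 1} f(y⁻¹ z₁ u y)` for `n ∈ N(𝔸_F)` of `U(J₂)` (termwise, §2) — the `N = 2`
counterpart of ★ `tsum_centre_conj_unipotent_mul`, now for the WHOLE `u`-sum. [cite: Rogawski1990, §7.3 (pp. 96–98)] -/
theorem tsum_rationalUnipotent_ne_one_unipotent_mul_two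
    (hz₁ : (z₁ : (quasiSplit F E c 2).Adelic) =
      (quasiSplit F E c 2).toAdelic (ratCenter F E c 2 ((StdForm.antidiagonal 2).over E) ζ))
    (f : (quasiSplit F E c 2).Adelic → ℂ)
    {n : (quasiSplit F E c 2).Adelic} (hn : n ∈ adelicUnipotent F E c 2) (y : (quasiSplit F E c 2).Adelic) :
    (∑' u : {u : rationalUnipotent F E c 2 // u ≠ 1},
      f ((n * y)⁻¹ *
        ((z₁ * ⟨(((u.1 : rationalUnipotent F E c 2) : adelicUnipotent F E c 2) : (quasiSplit F E c 2).Adelic),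
          (u.1 : rationalUnipotent F E c 2).2⟩ : (quasiSplit F E c 2).arithmeticSubgroup) :
            (quasiSplit F E c 2).Adelic) * (n * y))) =
    ∑' u : {u : rationalUnipotent F E c 2 // u ≠ 1},
      f (y⁻¹ * ((z₁ * ⟨(((u.1 : rationalUnipotent F E c 2) : adelicUnipotent F E c 2) :
        (quasiSplit F E c 2).Adelic), (u.1 : rationalUnipotent F E c 2).2⟩ :
          (quasiSplit F E c 2).arithmeticSubgroup) : (quasiSplit F E c 2).Adelic) * y) :=
  tsum_congr fun u => apply_conj_central_unipotent_mul_two ζ f hz₁ hn u.1 y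

end Sum

/-! ## §3 The bracket `ψ_T` is left `N(𝔸_F)`-invariant -/

section Bracket

variable [MeasurableSpace (adelicUnipotent F E c 2)] [BorelSpace (adelicUnipotent F E c 2)]

/-- **THE BRACKET OF THE `U(J₂)` UNIPOTENT TERM IS LEFT `N(𝔸_F)`-INVARIANT**, for `n ∈ adelicUnipotent F E c 2`:
`ψ_T(n y) = ψ_T(y)` with `ψ_T(y) = Σ'_{u ∈ N(F), u ≠ 1} f(y⁻¹ z₁ u y) − 1_{T < H(y)} K_{B,𝔬}(y, y)` spelled INLINE as in
★ B1_two (the `u`-sum by §2; the tail by §1). [cite: Rogawski1990, §7.3 (pp. 96–98)] [cite: Rogawski1990, Prop. 7.3.1 (p. 98)] -/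
theorem bracket_adelicUnipotent_mul_two {cl : (quasiSplit F E c 2).arithmeticSubgroup → ι}
    (hz₁ : (z₁ : (quasiSplit F E c 2).Adelic) =
      (quasiSplit F E c 2).toAdelic (ratCenter F E c 2 ((StdForm.antidiagonal 2).over E) ζ))
    (hclN : IsUnipotentInvariantOnBorel F E c 2 cl)
    (ν : Measure (adelicUnipotent F E c 2)) [ν.IsHaarMeasure]
    {𝓕 : Set (adelicUnipotent F E c 2)} (h𝓕 : IsFundamentalDomain (rationalUnipotent F E c 2) 𝓕 ν) (T : ℝ≥0)
    {f : (quasiSplit F E c 2).Adelic → ℂ} (hfc : Continuous f) (hf : HasCompactSupport f) {i : ι}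
    (hcl : ∀ γ : (quasiSplit F E c 2).arithmeticSubgroup, cl γ = i ↔
      ((adelicVal F E c 2 _ (γ : (quasiSplit F E c 2).Adelic) : GL (Fin 2) (AdeleRing (𝓞 E) E)) :
          Matrix (Fin 2) (Fin 2) (AdeleRing (𝓞 E) E)).charpoly =
        ((X - C ((ζ : Eˣ) : E)) ^ 2).map (algebraMap E (AdeleRing (𝓞 E) E)))
    {n : (quasiSplit F E c 2).Adelic} (hn : n ∈ adelicUnipotent F E c 2) (y : (quasiSplit F E c 2).Adelic) :
    (∑' u : {u : rationalUnipotent F E c 2 // u ≠ 1},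
      f ((n * y)⁻¹ *
        ((z₁ * ⟨(((u.1 : rationalUnipotent F E c 2) : adelicUnipotent F E c 2) : (quasiSplit F E c 2).Adelic),
          (u.1 : rationalUnipotent F E c 2).2⟩ : (quasiSplit F E c 2).arithmeticSubgroup) :
            (quasiSplit F E c 2).Adelic) * (n * y))) -
      kernelBorelTailClass ν 𝓕 T cl i f (n * y) =
    (∑' u : {u : rationalUnipotent F E c 2 // u ≠ 1},
      f (y⁻¹ * ((z₁ * ⟨(((u.1 : rationalUnipotent F E c 2) : adelicUnipotent F E c 2) :
        (quasiSplit F E c 2).Adelic), (u.1 : rationalUnipotent F E c 2).2⟩ :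
          (quasiSplit F E c 2).arithmeticSubgroup) : (quasiSplit F E c 2).Adelic) * y)) -
      kernelBorelTailClass ν 𝓕 T cl i f y := by
  rw [tsum_rationalUnipotent_ne_one_unipotent_mul_two ζ hz₁ f hn y,
    kernelBorelTailClass_unipotent_mul_central_two ζ ν h𝓕 hclN hcl hfc hf T hn y]

/-- **THE BRACKET IS LEFT `N(𝔸_F)`-INVARIANT — the binder `hN` of ★ (C-G)_two
`exists_weight_torus_kAverage_of_unipotent_invariant_two` at `ψ := ψ_T`**, token for token: for every
`n : unipotentInBorel F E c 2` (coerced through `B(𝔸_F)` into `G(𝔸_F)`) and every `y`, `ψ_T(↑n * y) = ψ_T(y)`. With ★ B1_two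
§2 (`bracket_rational_borel_mul_two`, `measurable_bracket_two`) and ★ (HINT)_two this makes the group → torus unfolding of
the `U(2)` unipotent term ONE application of ★ (C-G)_two (B) («`dg = |δ_B(m)|⁻¹ dn dm dk` … `m(N∖N) = 1`»).
[cite: Rogawski1990, §7.3 (pp. 96–98)] [cite: Arthur1981TraceFormulaInvariantForm, §2] -/
theorem bracket_unipotent_mul_two {cl : (quasiSplit F E c 2).arithmeticSubgroup → ι}
    (hz₁ : (z₁ : (quasiSplit F E c 2).Adelic) =
      (quasiSplit F E c 2).toAdelic (ratCenter F E c 2 ((StdForm.antidiagonal 2).over E) ζ))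
    (hclN : IsUnipotentInvariantOnBorel F E c 2 cl)
    (ν : Measure (adelicUnipotent F E c 2)) [ν.IsHaarMeasure]
    {𝓕 : Set (adelicUnipotent F E c 2)} (h𝓕 : IsFundamentalDomain (rationalUnipotent F E c 2) 𝓕 ν) (T : ℝ≥0)
    {f : (quasiSplit F E c 2).Adelic → ℂ} (hfc : Continuous f) (hf : HasCompactSupport f) {i : ι}
    (hcl : ∀ γ : (quasiSplit F E c 2).arithmeticSubgroup, cl γ = i ↔
      ((adelicVal F E c 2 _ (γ : (quasiSplit F E c 2).Adelic) : GL (Fin 2) (AdeleRing (𝓞 E) E)) :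
          Matrix (Fin 2) (Fin 2) (AdeleRing (𝓞 E) E)).charpoly =
        ((X - C ((ζ : Eˣ) : E)) ^ 2).map (algebraMap E (AdeleRing (𝓞 E) E)))
    (n : unipotentInBorel F E c 2) (y : (quasiSplit F E c 2).Adelic) :
    (∑' u : {u : rationalUnipotent F E c 2 // u ≠ 1},
      f ((((n : borelAdelic F E c 2) : (quasiSplit F E c 2).Adelic) * y)⁻¹ *
        ((z₁ * ⟨(((u.1 : rationalUnipotent F E c 2) : adelicUnipotent F E c 2) : (quasiSplit F E c 2).Adelic),
          (u.1 : rationalUnipotent F E c 2).2⟩ : (quasiSplit F E c 2).arithmeticSubgroup) :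
            (quasiSplit F E c 2).Adelic) * (((n : borelAdelic F E c 2) : (quasiSplit F E c 2).Adelic) * y))) -
      kernelBorelTailClass ν 𝓕 T cl i f (((n : borelAdelic F E c 2) : (quasiSplit F E c 2).Adelic) * y) =
    (∑' u : {u : rationalUnipotent F E c 2 // u ≠ 1},
      f (y⁻¹ * ((z₁ * ⟨(((u.1 : rationalUnipotent F E c 2) : adelicUnipotent F E c 2) :
        (quasiSplit F E c 2).Adelic), (u.1 : rationalUnipotent F E c 2).2⟩ :
          (quasiSplit F E c 2).arithmeticSubgroup) : (quasiSplit F E c 2).Adelic) * y)) -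
      kernelBorelTailClass ν 𝓕 T cl i f y :=
  bracket_adelicUnipotent_mul_two ζ hz₁ hclN ν h𝓕 T hfc hf hcl n.2 y

end Bracket

end UnitaryGroup

end Literature.NumberTheory.Automorphic

end
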